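import Summits.Ventures.CertifiedManyBodySolver.Downfold.EmeryOrbitalWeight
import HarnessLib

/-!
# The scalar LÖWDIN level of the Cu-d orbital in the σ three-band model and the quasiparticle-weight form of the
# Cu-d weight: `dWeight = (1 − dε_eff/dε)⁻¹` on the contour

Venture CertifiedManyBodySolver, cell `pub/hubbard-downfold` (stage S1 = ROUTER; technique B = band level), seat hubbard-downfold-mod-4;
namespace `Summit.Ventures.CertifiedManyBodySolver.Downfold.Emery`. Sequel of `EmeryOrbitalWeight` (p531292: `minorD`, `charCubic_expand_d`,
`sum_minors_eq_dcharCubic`, `dWeight = minorD/∂_ε charCubic`). Answers lit-1's «technique B = Löwdin at ε_F: the exact ε-dependence you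
linearise is now typed» (cell bus 2026-08-27T12:51:34Z) with the band-level side of the same identity, self-contained (no import of the
Literature file, whose v2 is in review): bridge to lit-1's `Literature/MathematicalPhysics/QuantumLattice/LoewdinDownfolding` (p530893: `effHam ε = H₀₀ − V₀₁(H₁₁ − ε)⁻¹V₁₀`,
`det(H − ε) = det(H₁₁ − ε)·det(effHam ε − ε)`, `effHam_sub_effHam` = the exact price of an energy-independent fold). For the
`(d | p_x, p_y)` split of `bloch4` the active block is 1 × 1, the passive determinant IS `minorD`, and the effective d LEVEL is the
scalar rational function `loewdinLevel ε = loewdinNum ε / minorD ε` below (gauge `ε_d = 0`). Three exact statements: the Schur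
determinant identity in this instance (`charCubic_eq_minorD_mul_sub`), the SELF-CONSISTENCY of the band energy
(`loewdinLevel_eq_self_of_contour`: the antibonding energy solves `ε = ε_eff(ε)` — technique B linearises nothing here; the
one-band `(t, t′, t″)` form is the approximation, quantified by the misfit floors of `EmeryOneBandMisfitFloor`), and the
QUASIPARTICLE-WEIGHT FORM of the Cu-d weight: `dWeight = (1 − dε_eff/dε)⁻¹` on the contour (`dWeight_eq_inv_one_sub_deriv`,
with `hasDerivAt_loewdinLevel` supplying the honest derivative) — the textbook `Z = (1 − ∂Σ/∂ω)⁻¹` of a level coupled to an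
eliminated subspace, here exact and elementary (prose sources: P.-O. Löwdin, J. Chem. Phys. 19, 1396 (1951), partitioning technique;
N. Marzari et al., Rev. Mod. Phys. 84, 1419 (2012) §III.B.2). Everything here is PROVED (0 sorry); one-body algebra and one quotient-rule
derivative; nothing about any material. -/

namespace Summit.Ventures.CertifiedManyBodySolver.Downfold.Emery

noncomputable section

/-- Numerator of the scalar Löwdin level: `R(ε) = V_dp·adj(H_pp − ε)·V_pd = 4t_pd²[x(Δ + 4cy + ε) + y(Δ + 4cx + ε)] + 32 t_pd² t_pp x y`
(the non-`minorD` part of `charCubic_expand_d`). [folklore] -/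
def loewdinNum (Δ tpd tpp c x y ε : ℝ) : ℝ :=
  4 * tpd ^ 2 * (x * (Δ + 4 * c * y + ε) + y * (Δ + 4 * c * x + ε)) + 32 * tpd ^ 2 * tpp * x * y

/-- **The energy-dependent effective Cu-d level** of the σ three-band model after eliminating `p_x, p_y` exactly at energy `ε`:
`ε_eff(ε) = R(ε)/minorD(ε)` (gauge `ε_d = 0`; defined where `minorD ≠ 0`, i.e. off the passive `p`-block spectrum).
[folklore] -/
def loewdinLevel (Δ tpd tpp c x y ε : ℝ) : ℝ := loewdinNum Δ tpd tpp c x y ε / minorD Δ tpp c x y ε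

/-- `charCubic = ε·minorD − R` (restatement of `charCubic_expand_d` with the numerator named). [folklore] -/
theorem charCubic_eq_mul_minorD_sub_loewdinNum (Δ tpd tpp c x y ε : ℝ) :
    charCubic Δ tpd tpp c x y ε = ε * minorD Δ tpp c x y ε - loewdinNum Δ tpd tpp c x y ε := by
  rw [charCubic_expand_d]; unfold loewdinNum; ring

/-- **Schur determinant identity, scalar instance**: off the passive spectrum, `charCubic = minorD·(ε − ε_eff(ε))`
(i.e. `det(H − ε) = det(H_pp − ε)·(ε_eff(ε) − ε)`). [folklore] -/
theorem charCubic_eq_minorD_mul_sub {Δ tpd tpp c x y ε : ℝ} (hD : minorD Δ tpp c x y ε ≠ 0) :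
    charCubic Δ tpd tpp c x y ε = minorD Δ tpp c x y ε * (ε - loewdinLevel Δ tpd tpp c x y ε) := by
  rw [charCubic_eq_mul_minorD_sub_loewdinNum, loewdinLevel, mul_sub, mul_div_cancel₀ _ hD]
  ring

/-- **Self-consistency of the band energy**: on the contour (off the passive spectrum) the energy IS the Löwdin level,
`ε_eff(ε) = ε`. [folklore] -/
theorem loewdinLevel_eq_self_of_contour {Δ tpd tpp c x y ε : ℝ} (hP : charCubic Δ tpd tpp c x y ε = 0)
    (hD : minorD Δ tpp c x y ε ≠ 0) : loewdinLevel Δ tpd tpp c x y ε = ε := by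
  have h := charCubic_eq_minorD_mul_sub (tpd := tpd) hD
  rw [hP] at h
  have h2 : ε - loewdinLevel Δ tpd tpp c x y ε = 0 := by
    rcases mul_eq_zero.1 h.symm with h0 | h0
    · exact absurd h0 hD
    · exact h0
  linarith

/-- The energy derivative of the Löwdin level (quotient rule, as a closed form):
`ε_eff′(ε) = [4t_pd²(x + y)·minorD − R·(2ε + 2Δ + 4c(x + y))]/minorD²`. [folklore] -/
def loewdinLevelDeriv (Δ tpd tpp c x y ε : ℝ) : ℝ :=
  (4 * tpd ^ 2 * (x + y) * minorD Δ tpp c x y ε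
      - loewdinNum Δ tpd tpp c x y ε * (2 * ε + 2 * Δ + 4 * c * (x + y))) / minorD Δ tpp c x y ε ^ 2

/-- `R` is affine in `ε` with slope `4t_pd²(x + y)`. [folklore] -/
theorem hasDerivAt_loewdinNum (Δ tpd tpp c x y ε : ℝ) :
    HasDerivAt (fun e => loewdinNum Δ tpd tpp c x y e) (4 * tpd ^ 2 * (x + y)) ε := by
  have hfun : (fun e => loewdinNum Δ tpd tpp c x y e) = fun e => 4 * tpd ^ 2 * (x + y) * e
      + (4 * tpd ^ 2 * (x * (Δ + 4 * c * y) + y * (Δ + 4 * c * x)) + 32 * tpd ^ 2 * tpp * x * y) := by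
    funext e; unfold loewdinNum; ring
  rw [hfun]
  have h := ((hasDerivAt_id ε).const_mul (4 * tpd ^ 2 * (x + y))).add_const
    (4 * tpd ^ 2 * (x * (Δ + 4 * c * y) + y * (Δ + 4 * c * x)) + 32 * tpd ^ 2 * tpp * x * y)
  simpa using h

/-- `minorD` is quadratic in `ε` with derivative `2ε + 2Δ + 4c(x + y)`. [folklore] -/
theorem hasDerivAt_minorD (Δ tpp c x y ε : ℝ) :
    HasDerivAt (fun e => minorD Δ tpp c x y e) (2 * ε + 2 * Δ + 4 * c * (x + y)) ε := by
  have h1 : HasDerivAt (fun e : ℝ => -Δ - 4 * c * x - e) (-1) ε := by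
    simpa using (hasDerivAt_id ε).const_sub (-Δ - 4 * c * x)
  have h2 : HasDerivAt (fun e : ℝ => -Δ - 4 * c * y - e) (-1) ε := by
    simpa using (hasDerivAt_id ε).const_sub (-Δ - 4 * c * y)
  have hfun : (fun e => minorD Δ tpp c x y e) = fun e => (-Δ - 4 * c * x - e) * (-Δ - 4 * c * y - e) - 16 * tpp ^ 2 * x * y := by
    funext e; unfold minorD; ring
  rw [hfun]
  have h : HasDerivAt (fun e : ℝ => (-Δ - 4 * c * x - e) * (-Δ - 4 * c * y - e) - 16 * tpp ^ 2 * x * y)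
      (-1 * (-Δ - 4 * c * y - ε) + (-Δ - 4 * c * x - ε) * -1) ε := (h1.mul h2).sub_const (16 * tpp ^ 2 * x * y)
  exact h.congr_deriv (by ring)

/-- **The honest derivative**: off the passive spectrum, `ε ↦ ε_eff(ε)` is differentiable with derivative `loewdinLevelDeriv`.
[folklore] -/
theorem hasDerivAt_loewdinLevel {Δ tpd tpp c x y ε : ℝ} (hD : minorD Δ tpp c x y ε ≠ 0) :
    HasDerivAt (fun e => loewdinLevel Δ tpd tpp c x y e) (loewdinLevelDeriv Δ tpd tpp c x y ε) ε := by
  have h := (hasDerivAt_loewdinNum Δ tpd tpp c x y ε).div (hasDerivAt_minorD Δ tpp c x y ε) hD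
  unfold loewdinLevelDeriv loewdinLevel
  exact h

/-- **`1 − ε_eff′ = ∂_ε charCubic / minorD` on the contour** (off the passive spectrum). [folklore] -/
theorem one_sub_loewdinLevelDeriv {Δ tpd tpp c x y ε : ℝ} (hP : charCubic Δ tpd tpp c x y ε = 0)
    (hD : minorD Δ tpp c x y ε ≠ 0) :
    1 - loewdinLevelDeriv Δ tpd tpp c x y ε = dcharCubic Δ tpd tpp c x y ε / minorD Δ tpp c x y ε := by
  have hR : loewdinNum Δ tpd tpp c x y ε = ε * minorD Δ tpp c x y ε := by
    have h := charCubic_eq_mul_minorD_sub_loewdinNum Δ tpd tpp c x y ε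
    rw [hP] at h; linarith
  unfold loewdinLevelDeriv
  rw [hR, ← sum_minors_eq_dcharCubic]
  field_simp
  unfold minorD minorX minorY
  ring

/-- **QUASIPARTICLE-WEIGHT FORM OF THE Cu-d WEIGHT**: on the contour, off the passive spectrum and off band crossings
(`∂_ε charCubic ≠ 0`), `dWeight = (1 − dε_eff/dε)⁻¹` — the `Z = (1 − ∂Σ/∂ω)⁻¹` of the downfolded d level, exactly.
[folklore] -/
theorem dWeight_eq_inv_one_sub_deriv {Δ tpd tpp c x y ε : ℝ} (hP : charCubic Δ tpd tpp c x y ε = 0)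
    (hD : minorD Δ tpp c x y ε ≠ 0) :
    dWeight Δ tpd tpp c x y ε = (1 - loewdinLevelDeriv Δ tpd tpp c x y ε)⁻¹ := by
  rw [one_sub_loewdinLevelDeriv hP hD, inv_div, dWeight_eq_div_dcharCubic]

end

end Summit.Ventures.CertifiedManyBodySolver.Downfold.Emery
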